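import Summits.ResolutionOfSingularities.ResolutionOfSingularities.Theorems.WeightedInvariantIota3DropCurveIntegerSlope
import HarnessLib

/-!
# The residual (D-b³-curve-FRAC) NORMALISED: at a curve centre the integer contact level is `b_max = ⌊r/q⌋` and `J₃ᵗ = 𝒥((y, x); (⌊r/q⌋, 1))`
# for the AQS-ADAPTED pair `(x, y)` itself (door `HypersurfaceCentreConstruction`, stmt-ResolutionOfSingularities-19897;
# gap list `keyRungGrHomLE_three_of_tieDescent_point_curveFrac` of `stub_keyRungGrHomLE_three`)

Helper for `stub_keyRungGrHomLE_three` (def-free, `--supports 19897`).  Sequel of hand -8's …Iota3DropCurveAQSDatum / …Iota3DropCurveIntegerSlope /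
…KeyRungThreeOfDropCurveFrac.  The hypothesis (D-b³-curve-FRAC) hands the prover a curve centre `P = (x, y)` of a three-dimensional door position
with the Abramovich–Quek–Schober germ `(y/1, x/1; r, q; rν)` of `f/1`, `q ≥ 2`, presented by a regular system of parameters `(x, y, z)` of `S`, and a
presentation `(u, w)` of `J₃ᵗ`.  THIS FILE identifies `J₃ᵗ` in those coordinates:

* **`Iota3.weightedMonomialIdeal_le_div`** — `𝒥_{rν}((y, x); (r, q)) ≤ 𝒥_{bν}((y, x); (b, 1))`, `b = ⌊r/q⌋` (`0 < q`): an AQS-admissible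
  element is admissible for the integer weights `(⌊r/q⌋, 1)` on the SAME pair.
* **`Iota3.bMax_eq_div_of_lexMax`** — in an excellent regular local ring of dimension `2`, for `f ≠ 0` not of monomial type with lex-maximal germ
  `(y₁, x₁; r, q; rν)`: `b_max f = ⌊r/q⌋`, attained by the AQS contact parameter `y₁` (reached by `weightedMonomialIdeal_le_div`; every reached
  integer level `b'` gives the admissible centre `(g, x'; b', 1; b'ν)`, so `b' q ≤ r` by lex-maximality).
* **`Iota3.jFlatT_eq_of_curve_lexMax`** — at the curve centre: `1 ≤ ⌊r/q⌋`, `f ∈ 𝒥_{⌊r/q⌋ν}((y, x); (⌊r/q⌋, 1))` and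
  `jFlatT S f = 𝒥((y, x); (⌊r/q⌋, 1))` (all degrees) FOR THE AQS-ADAPTED PAIR — so in (D-b³-curve-FRAC) one may take the integer-contact datum
  of …Iota3DropCurveDatum on the AQS coordinates: every monomial `x^i y^j z^k` (`j < ν`) of `f` then has `q i ≥ r (ν − j) > q b (ν − j)`, the strict
  transform in the `x`-chart is `≡ c Y^ν (mod s)`, and the only successor over `𝔪` that can keep the order is `(s, Y, z)` (CURVE-TIE.md §3).
[OURS · L1 W4.3 · audit glue; AI work, weaker than expert review; nothing here is a statement of the manuscript under review.]

## References

* D. Abramovich, M. H. Quek, B. Schober, arXiv:2507.01232 (2025), Thm 3.5. [AbramovichQuekSchober2025]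
* V. Cossart, U. Jannsen, S. Saito, LNM 2270 (2020), Ch. 8. [CossartJannsenSaito2020]
-/

noncomputable section

set_option linter.dupNamespace false -- mandated namespace of this single-conjunct summit

open IsLocalRing Literature.AlgebraicGeometry.Resolution
open Summit.ResolutionOfSingularities.ResolutionOfSingularities.Theorems
open Summit.ResolutionOfSingularities.ResolutionOfSingularities.Theorems.ContactCylinder

namespace Summit.ResolutionOfSingularities.ResolutionOfSingularities.Cruxes.HypersurfaceCentreConstruction.LocalEngine

namespace Iota3

/-! ## AQS admissibility implies integer admissibility at level `⌊r/q⌋` -/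

/-- The arithmetic of the floor: `rν ≤ r i + q j` forces `⌊r/q⌋ ν ≤ ⌊r/q⌋ i + j` (`0 < q`). [folklore] -/
theorem div_mul_le_of_weights {q r ν i j : ℕ} (hq : 0 < q) (h : r * ν ≤ r * i + q * j) : r / q * ν ≤ r / q * i + j := by
  rcases (le_or_gt ν i)  with hνi | hiν
  · exact (Nat.mul_le_mul_left _ hνi).trans (Nat.le_add_right _ _)
  · -- `r (ν - i) ≤ q j` and `⌊r/q⌋ q ≤ r`
    have h1 : r * (ν - i) ≤ q * j := by
      rw [Nat.mul_sub]
      exact Nat.sub_le_iff_le_add'.mpr h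
    have h2 : r / q * (ν - i) * q ≤ q * j :=
      calc r / q * (ν - i) * q = r / q * q * (ν - i) := by ring
        _ ≤ r * (ν - i) := Nat.mul_le_mul_right _ (Nat.div_mul_le_self r q)
        _ ≤ q * j := h1
    have h3 : r / q * (ν - i) ≤ j := Nat.le_of_mul_le_mul_right (by rw [Nat.mul_comm q j] at h2; exact h2) hq
    calc r / q * ν = r / q * i + r / q * (ν - i) := by rw [← Nat.mul_add, Nat.add_sub_cancel' hiν.le]
      _ ≤ r / q * i + j := Nat.add_le_add_left h3 _

/-- **`𝒥_{rν}((y, x); (r, q)) ≤ 𝒥_{⌊r/q⌋ν}((y, x); (⌊r/q⌋, 1))`** (`0 < q`). [OURS · L1 W4.3] -/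
theorem weightedMonomialIdeal_le_div {S : Type} [CommRing S] (y x : S) {q r : ℕ} (hq : 0 < q) (ν : ℕ) :
    weightedMonomialIdeal ![y, x] ![r, q] (r * ν) ≤ weightedMonomialIdeal ![y, x] ![r / q, 1] (r / q * ν) :=
  AQSHeightTwo.weightedMonomialIdeal_two_le fun i j hij =>
    AQSHeightTwo.monomial_mem y x (r / q) 1 (by rw [one_mul]; exact div_mul_le_of_weights hq hij)

/-! ## `b_max = ⌊r/q⌋` for a lex-maximal germ `(r, q)` -/

/-- **The terminal integer contact level of an AQS datum with weights `(r, q)` is `⌊r/q⌋`, attained by its contact parameter.**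
[OURS · L1 W4.3] [cite: AbramovichQuekSchober2025, Thm 3.5] [cite: CossartJannsenSaito2020, Ch. 8] -/
theorem bMax_eq_div_of_lexMax (O : Type) [CommRing O] [IsRegularLocalRing O] (hS : IsExcellentRing O)
    (hdim : ringKrullDim O = (2 : ℕ)) {f : O} (hf0 : f ≠ 0) (hnm : ¬ IsMonomialType f)
    {x₁ y₁ : O} (hx₁y₁ : Ideal.span {x₁, y₁} = maximalIdeal O) {q r ν : ℕ} (hν : (adicOrder f).toNat = ν) (hν1 : 1 ≤ ν)
    (hlex : IsLexMaxWeightedCentreGerm O (Ideal.span {f}) ![y₁, x₁] ![r, q] (r * ν)) :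
    bMax f = r / q ∧ f ∈ contactFiltration y₁ (bMax f) (bMax f * (adicOrder f).toNat) := by
  obtain ⟨-, hpos, -, hqr, -, -, hadm, hmax, -⟩ := hlex
  have hq : 0 < q := hpos 1
  have hqr' : q ≤ r := hqr
  have hb1 : 1 ≤ r / q := (Nat.le_div_iff_mul_le hq).mpr (by rw [one_mul]; exact hqr')
  have hdim2 : ringKrullDim O = 2 := by rw [hdim]; rfl
  obtain ⟨-, hy₁2⟩ := LocalGameEFTSteepening.not_mem_sq_of_span_pair_eq hdim hx₁y₁
  have hy₁ : y₁ ∈ maximalIdeal O := hx₁y₁ ▸ Ideal.subset_span (by simp)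
  -- `⌊r/q⌋` is reached by `y₁`
  have hreach : f ∈ contactFiltration y₁ (r / q) (r / q * ν) := by
    have h := weightedMonomialIdeal_le_div y₁ x₁ hq ν ((Ideal.span_singleton_le_iff_mem _).mp hadm)
    rw [AQSHeightTwo.weightedMonomialIdeal_swap, ContactFiltration.weightedMonomialIdeal_eq_contactFiltration hx₁y₁ hb1,
      ← contactFiltration_def] at h
    exact h
  have hf2 : f ∈ maximalIdeal O ^ 2 := mem_sq_of_not_isMonomialType hf0 hnm ⟨y₁, hy₁, hy₁2⟩
  have hle : r / q ≤ bMax f := le_bMax_of_reaches O hS hf0 hf2 hnm hb1 ⟨y₁, hy₁, hy₁2, by rw [hν]; exact hreach⟩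
  -- every reached level `b'` has `b' q ≤ r`
  obtain ⟨hB1, g, hg, hg2, hgreach⟩ := one_le_bMax_and_reaches O hS hf0 hf2 hnm
  rw [hν] at hgreach
  obtain ⟨x', -, hx'g⟩ := GenericEquimultiplicity.exists_span_pair_eq_maximalIdeal_of_not_mem_sq hdim2 hg hg2
  have hadm' : Ideal.span {f} ≤ weightedMonomialIdeal ![g, x'] ![bMax f, 1] (bMax f * ν) := by
    rw [Ideal.span_singleton_le_iff_mem, AQSHeightTwo.weightedMonomialIdeal_swap,
      ContactFiltration.weightedMonomialIdeal_eq_contactFiltration hx'g hB1, ← contactFiltration_def]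
    exact hgreach
  have hrange : Ideal.span (Set.range ![g, x']) = maximalIdeal O := by
    rw [show Set.range ![g, x'] = {g, x'} by
      rw [Matrix.range_cons, Matrix.range_cons, Matrix.range_empty, Set.union_empty, Set.singleton_union],
      Ideal.span_pair_comm, hx'g]
  have hcmp := hmax ![g, x'] ![bMax f, 1] (bMax f * ν) hrange
    (fun i => by fin_cases i; exacts [hB1, Nat.one_pos]) hB1 (Nat.mul_pos hB1 hν1) hadm'
  simp only [Matrix.cons_val_zero, Matrix.cons_val_one, mul_one] at hcmp
  have hge : bMax f ≤ r / q := by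
    rcases hcmp with h1 | ⟨-, h2⟩
    · exfalso
      have : bMax f * ν * r = r * ν * bMax f := by ring
      omega
    · refine (Nat.le_div_iff_mul_le hq).mpr (Nat.le_of_mul_le_mul_right ?_ hν1)
      calc bMax f * q * ν = bMax f * ν * q := by ring
        _ ≤ r * ν := h2
        _ = r * ν := rfl
  have hbr : bMax f = r / q := le_antisymm hge hle
  refine ⟨hbr, ?_⟩
  rw [hbr, hν]; exact hreach

/-! ## `J₃ᵗ` in the AQS coordinates at a curve centre -/

/-- **`J₃ᵗ = 𝒥((y, x); (⌊r/q⌋, 1))` FOR THE AQS-ADAPTED PAIR at a curve centre of a three-dimensional door position** (hypotheses as in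
`dropb3_curve_of_integer_slope`, general `q`): `1 ≤ ⌊r/q⌋`, `f ∈ 𝒥_{⌊r/q⌋ν}((y, x); (⌊r/q⌋, 1))` and `jFlatT S f m = 𝒥ₘ((y, x); (⌊r/q⌋, 1))` for
all `m`. [OURS · L1 W4.3 · (D-b³-curve-FRAC) normal form] [cite: AbramovichQuekSchober2025, Thm 3.5] -/
theorem jFlatT_eq_of_curve_lexMax (k₀ : Type) [Field k₀]
    (S : Type) [CommRing S] [Algebra k₀ S] [Algebra.EssFiniteType k₀ S] [IsRegularLocalRing S]
    (f : S) (hd : ringKrullDim S = 3) (hf0 : f ≠ 0) (hf : f ∈ maximalIdeal S)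
    (P : Ideal S) [P.IsPrime]
    (hE : topStratum iotaOrdEpsTau S f = {𝔮 | P ≤ 𝔮.asIdeal}) (hP1 : ¬ ringKrullDim (Localization.AtPrime P) ≤ 1)
    (hPm : P ≠ maximalIdeal S) {x y z : S} (hPeq : Ideal.span ({x, y} : Set S) = P) (hxyz : Ideal.span {x, y, z} = maximalIdeal S)
    {q r ν : ℕ} (hfν : f ∈ maximalIdeal S ^ ν) (hfν1 : f ∉ maximalIdeal S ^ (ν + 1))
    (hlex : IsLexMaxWeightedCentreGerm (Localization.AtPrime P) (Ideal.span {algebraMap S (Localization.AtPrime P) f})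
      ![algebraMap S (Localization.AtPrime P) y, algebraMap S (Localization.AtPrime P) x] ![r, q] (r * ν)) :
    1 ≤ r / q ∧ f ∈ weightedMonomialIdeal ![y, x] ![r / q, 1] (r / q * ν) ∧
      ∀ m : ℕ, jFlatT S f m = weightedMonomialIdeal ![y, x] ![r / q, 1] m := by
  classical
  subst hPeq
  haveI : IsDomain S := isDomain_of_isRegularLocalRing S
  have hdle : ringKrullDim S ≤ 3 := le_of_eq hd
  have hd3 : ringKrullDim S = (3 : ℕ) := by rw [hd]; rfl
  have hrk : (maximalIdeal S).spanFinrank = 3 := by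
    have h := IsRegularLocalRing.spanFinrank_maximalIdeal (R := S)
    rw [hd3] at h
    exact_mod_cast h
  have hq : 0 < q := hlex.2.1 1
  have hqr : q ≤ r := hlex.2.2.2.1
  have hb1 : 1 ≤ r / q := (Nat.le_div_iff_mul_le hq).mpr (by rw [one_mul]; exact hqr)
  have hadmO := (Ideal.span_singleton_le_iff_mem _).mp hlex.2.2.2.2.2.2.1
  -- the order and the pair `(x, y)`
  obtain ⟨ν', hν'⟩ := Ordinal.lt_omega0.mp (iotaOrd_lt_omega0_of_ne_zero S hf0)
  obtain ⟨hfν', hfν1'⟩ := (iotaOrd_eq_natCast_iff S f ν').mp hν'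
  obtain rfl : ν = ν' := eq_of_mem_pow_of_not_mem_pow hfν hfν1 hfν' hfν1'
  have hν1 : 1 ≤ ν := by
    by_contra h
    have h0 : ν = 0 := by omega
    rw [h0, zero_add, pow_one] at hfν1
    exact hfν1 hf
  have hP₀ : topStratumPrime iotaOrdEpsTau S f = Ideal.span {x, y} :=
    ContactCylinder.topStratumPrime_eq_of_topStratum_eq iotaOrdEpsTau S f hE
  obtain ⟨_, -, -, -, -, hfPν⟩ := topStratumPrime_iotaOrdEpsTau_spec hdle hf0 hf hν'
  rw [hP₀] at hfPν
  have hr₀ : Ideal.span (Set.range ![x, y, z]) = maximalIdeal S := by rw [range_three]; exact hxyz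
  have hxg : ∀ i, (![x, y] : Fin 2 → S) i ∈ maximalIdeal S := LocalGameEFTCylinder.mem_maximalIdeal_pair hr₀
  have hli := LocalGameEFTCylinder.linearIndependent_toCotangent_pair hr₀ hrk
  -- the position `(S_P, f/1)`
  set O := Localization.AtPrime (Ideal.span ({x, y} : Set S)) with hO
  haveI : IsRegularLocalRing O := isRegularLocalRing_localization_atPrime S _
  haveI : Algebra.EssFiniteType k₀ O := Algebra.EssFiniteType.comp k₀ S O
  have hexc : IsExcellentRing O := (Stacks07QW_field_holds k₀ k₀ inferInstance).of_essFiniteType inferInstance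
  have hdimO : ringKrullDim O = (2 : ℕ) :=
    ringKrullDim_localization_eq_two_of_curveCentre hd (Ideal.span ({x, y} : Set S)) hP1 hPm
  have hdimP : ringKrullDim O ≤ 2 := le_of_eq (hdimO.trans rfl)
  have hf0' : algebraMap S O f ≠ 0 := fun h =>
    hf0 ((injective_iff_map_eq_zero _).mp
      (IsLocalization.injective O (Ideal.span ({x, y} : Set S)).primeCompl_le_nonZeroDivisors) f h)
  obtain ⟨hmax₀, hy2, -, -⟩ := Descent.pair_facts (Ideal.span ({x, y} : Set S)) hxg hli rfl
  have hnm : ¬ IsMonomialType (algebraMap S O f) :=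
    JFlatEssSmooth.not_isMonomialType_of_topStratumPrime_eq hdle hf0 hf x y hxg hli hP₀
  have hιP : iotaOrd O (algebraMap S O f) = iotaOrd S f :=
    EquimultipleCentre.iotaOrd_localization_eq_of_mem_pow (Ideal.span ({x, y} : Set S)) le_rfl hν' hfPν
  obtain ⟨hfνO, hfνO1⟩ := (iotaOrd_eq_natCast_iff O _ ν).mp (hιP.trans hν')
  have hνO : (adicOrder (algebraMap S O f)).toNat = ν := by
    obtain ⟨ν₂, -, hν₂, -, h1, h2⟩ := exists_adicOrder_eq_of_not_isMonomialType hf0' hnm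
      ⟨_, hmax₀ ▸ Ideal.subset_span (by simp), hy2⟩
    rw [hν₂]; exact (eq_of_mem_pow_of_not_mem_pow hfνO hfνO1 h1 h2).symm
  -- `b_max = ⌊r/q⌋`, the cylinder value, admissibility
  obtain ⟨hbr, hreach⟩ := bMax_eq_div_of_lexMax O hexc hdimO hf0' hnm hmax₀ hνO hν1 hlex
  have hb : 1 ≤ bMax (algebraMap S O f) := by rw [hbr]; exact hb1
  have hcyl : ∀ m : ℕ, (jContact O (algebraMap S O f) m).comap (algebraMap S O) =
      weightedMonomialIdeal ![x, y] ![1, bMax (algebraMap S O f)] m :=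
    fun m => cylinder_comap_eq_weightedMonomialIdeal S x y hxg hli f hf0' hnm hreach hb m
  have hJ : ∀ m : ℕ, jFlatT S f m = weightedMonomialIdeal ![y, x] ![r / q, 1] m := fun m => by
    rw [jFlatT_eq_cylinderAt_jContact S f m hE hdimP, cylinderAt_def, hcyl m, hbr, AQSHeightTwo.weightedMonomialIdeal_swap]
  have hadm : f ∈ weightedMonomialIdeal ![y, x] ![r / q, 1] (r / q * ν) := by
    rw [← hJ (r / q * ν), jFlatT_eq_cylinderAt_jContact S f _ hE hdimP, cylinderAt_def, Ideal.mem_comap,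
      ← weightedMonomialIdeal_eq_jContact O hf0' hnm hmax₀ hy2 hb hreach (r / q * ν), hbr, AQSHeightTwo.weightedMonomialIdeal_swap]
    exact weightedMonomialIdeal_le_div _ _ hq ν hadmO
  exact ⟨hb1, hadm, hJ⟩

end Iota3

end Summit.ResolutionOfSingularities.ResolutionOfSingularities.Cruxes.HypersurfaceCentreConstruction.LocalEngine

end
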